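import Literature.Analysis.FluidPDE.ESSLocalHolderBlowupFarFieldBound
import Literature.Analysis.FluidPDE.PressureDecayEstimateProofs
import HarnessLib

/-!
# Far-field boundedness of a local energy ancient solution from far-field smallness of the
# velocity alone (Wang–Zhang 2017, §4 Step 1, last paragraph)

Analysis/FluidPDE proofs-only file (theorems only: no definition, no named fact; nothing accepted
is restated or changed). In the `L_{3,∞}` blow-up argument of Escauriaza–Seregin–Šverák (Russ.
Math. Surveys 58 (2003), §3 (3.21)–(3.24)) the blow-up limit `(w, π)` lies in
`L³ × L^{3/2}(]-T, 0[ × ℝ³)` globally, so `∫_{Q(z₀,1)} (|w|³ + |π|^{3/2}) → 0` as `|x₀| → ∞` and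
the ε-regularity theorem bounds `w` in the far field (`exists_farField_ae_norm_le_one`,
`ESSLocalHolderBlowupFarFieldBound.lean`). For the blow-up limit of a solution bounded in a
critical Besov space (W. Wang, Z. Zhang, *Blow-up of critical norms for the 3-D Navier–Stokes
equations*, Sci. China Math. 60 (2017) = arXiv:1510.02589, §4 Step 1: "(4.5)
`∫_{Q_1(z₀)} |v₃|³ → 0` as `|z_0| → ∞` … Theorem 1.4 ensures that there exists `R > 0` such that
`v` is regular in `(ℝ³ ∖ B_R) × (-T, 0)` with the bound `|v| + |∇v| ≤ C`") only the **velocity**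
is small in the far field, while the pressure is merely bounded in the scale-invariant quantity
`D(1; z₀) ≤ K`. This file proves the far-field bound in that situation, by the standard device:
the pressure decay estimate `D(θ; z₀) ≤ c (θ D(1; z₀) + θ⁻² C(1; z₀))`
(`seregin_sverak_pressure_decay_holds`, Seregin–Šverák 2009 (as13)) makes *both* `C` and `D`
small at a fixed smaller scale `θ = θ(K)`, and the one-scale ε-regularity theorem
(`RRS2016.theorem15_3_holds`) applied to the `θ`-zoom bounds `|w| ≤ c_M ε₁^{1/3} θ⁻¹` near every
far point.

## Contents

* `ae_norm_le_of_ae_norm_le_zoom` — transport of an a.e. bound from `Q(1/2)` of the zoomed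
  field `θ w(t₂ + θ² ·, x₂ + θ ·)` back to `Q(z₂, θ/2)`;
* `ae_norm_le_near_point_of_small_scale` — **ε-regularity at scale `θ` near a point of negative
  time** for a pair suitable in every `Q(a)`: `C(θ; z₂) + D(θ; z₂) ≤ ε₀ ≤ ε₁` gives
  `|w| ≤ c_M ε₀^{1/3} / θ` a.e. on `Q(z₂, θ/2)`;
* `cknC_add_cknD_small_of_cknC_one_small` — the choice of `θ(K)` and `η(K)`: `D(1; z) ≤ K`,
  `C(1; z) ≤ η` imply `C(θ; z) + D(θ; z) ≤ ε₁`;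
* `exists_farField_ae_norm_le_of_cknC_farField_small` — **the far-field bound**: if
  `D(1; z₀) ≤ K` at every apex `z₀` with `t₀ < 0` and `C(1; z₀) → 0` as `|x₀| → ∞` uniformly in
  `-(T+1) < t₀ < 0`, then `|w| ≤ L` a.e. on `]-T, 0[ × {|x| > R₀}` for some `L`, `R₀`.

## References

* W. Wang, Z. Zhang, Sci. China Math. 60 (2017) 637–650 = arXiv:1510.02589, §4 Step 1.
  [WangZhang2016]
* L. Escauriaza, G. Seregin, V. Šverák, Russ. Math. Surveys 58 (2003), §3 (3.21)–(3.24).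
  [EscauriazaSereginSverak2003]
* G. Seregin, V. Šverák, Comm. PDE 34 (2009) = arXiv:0804.1803, proof of Lemma 3.5, (as13).
  [SereginSverak2009]
* J. C. Robinson, J. L. Rodrigo, W. Sadowski, *The three-dimensional Navier–Stokes equations*,
  CUP (2016), Thm. 15.3. [RobinsonRodrigoSadowski2016]
-/

noncomputable section

open MeasureTheory TopologicalSpace Set Function Filter Metric
open _root_.Topology
open scoped ENNReal NNReal InnerProductSpace RealInnerProductSpace

namespace Literature.Analysis.FluidPDE

variable {w : ℝ → EuclideanSpace ℝ (Fin 3) → EuclideanSpace ℝ (Fin 3)}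
  {π : ℝ → EuclideanSpace ℝ (Fin 3) → ℝ}

/-! ### Transport of a.e. bounds along the zoom -/

section Transport

/-- **Transport of an a.e. bound back along the zoom**: if the zoomed field
`U(s, y) = θ w(t₂ + θ² s, x₂ + θ y)` satisfies `|U| ≤ B` a.e. on `Q(1/2)`, then `|w| ≤ B/θ` a.e. on
`Q(z₂, θ/2)` (the inverse zoom is quasi-measure-preserving and maps `Q(z₂, θ/2)` into `Q(1/2)`).
[folklore] -/
theorem ae_norm_le_of_ae_norm_le_zoom {θ : ℝ} (hθ : 0 < θ) (z₂ : ℝ × EuclideanSpace ℝ (Fin 3))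
    {B : ℝ}
    (h : ∀ᵐ z ∂(volume.restrict (parabolicCylinder (1 / 2) (0 : ℝ × EuclideanSpace ℝ (Fin 3)))),
      ‖(θ • stPull (θ ^ 2) θ z₂.1 z₂.2 w) z.1 z.2‖ ≤ B) :
    ∀ᵐ z ∂(volume.restrict (parabolicCylinder (θ / 2) z₂)), ‖w z.1 z.2‖ ≤ B / θ := by
  have hθ2 : 0 < θ ^ 2 := pow_pos hθ 2
  rw [ae_restrict_iff' (isOpen_parabolicCylinder _ _).measurableSet] at h ⊢
  -- the inverse zoom
  set Ψ : ℝ × EuclideanSpace ℝ (Fin 3) → ℝ × EuclideanSpace ℝ (Fin 3) :=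
    stAffine (θ ^ 2)⁻¹ θ⁻¹ (-((θ ^ 2)⁻¹ * z₂.1)) (-(θ⁻¹ • z₂.2)) with hΨ
  have hq : Measure.QuasiMeasurePreserving Ψ (volume : Measure (ℝ × EuclideanSpace ℝ (Fin 3))) volume :=
    quasiMeasurePreserving_stAffine (inv_pos.2 hθ2) (inv_pos.2 hθ) _ _
  have hΨsymm : Ψ = ⇑(stAffineHomeomorph hθ2.ne' hθ.ne' z₂.1 z₂.2).symm := by
    rw [stAffineHomeomorph_symm_eq]
  filter_upwards [hq.ae h] with z hz hzmem
  have hin : Ψ z ∈ parabolicCylinder (1 / 2) (0 : ℝ × EuclideanSpace ℝ (Fin 3)) := by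
    have h1 := zoom_symm_mem_parabolicCylinder hθ z₂ hzmem
    have e : θ / 2 / θ = 1 / 2 := by field_simp
    rw [e] at h1
    exact h1
  have hb := hz hin
  -- `U(Ψ z) = θ w(z)`
  have hback : stAffine (θ ^ 2) θ z₂.1 z₂.2 (Ψ z) = z := by
    rw [hΨsymm]; exact stAffine_apply_symm hθ2.ne' hθ.ne' z₂.1 z₂.2 z
  have hval : (θ • stPull (θ ^ 2) θ z₂.1 z₂.2 w) (Ψ z).1 (Ψ z).2 = θ • w z.1 z.2 := by
    have e1 : (θ • stPull (θ ^ 2) θ z₂.1 z₂.2 w) (Ψ z).1 (Ψ z).2 =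
        θ • uncurry w (stAffine (θ ^ 2) θ z₂.1 z₂.2 (Ψ z)) := by
      rw [smul_stPull_apply, stAffine_apply]; rfl
    rw [e1, hback]; rfl
  rw [hval, norm_smul, Real.norm_eq_abs, abs_of_pos hθ] at hb
  rw [le_div_iff₀ hθ, mul_comm]
  exact hb

end Transport

/-! ### ε-regularity at scale `θ` near a point of negative time -/

section NearPoint

/-- **ε-regularity at scale `θ` near a point of negative time, for a pair suitable in every
`Q(a)`.** Let `(w, π)` be suitable in every `Q(a)`, `a > 0`, let `0 < θ ≤ 1`, `z₂ = (t₂, x₂)` with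
`t₂ < 0`, and suppose `C(θ; z₂) + D(θ; z₂) ≤ ε₀` with `0 < ε₀ ≤ ε₁` (`ε₁, c_M` the constants of
RRS Thm. 15.3). Then `|w| ≤ c_M ε₀^{1/3} / θ` a.e. on `Q(z₂, θ/2)`. Proof: the zoom
`U = θ w(t₂ + θ²·, x₂ + θ·)`, `P = θ² π(…)` is a suitable weak solution on the preimage of a large
cylinder `Q(a)` (`IsSuitableWeakSolutionOn.stRescale`), an open set containing the closure of
`Q(1)` because `t₂ < 0`; its `L³ × L^{3/2}(Q(1))` size is `C(θ; z₂) + D(θ; z₂)`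
(`lintegral_cube_zoom`, `lintegral_pressure_zoom`); RRS Thm. 15.3 bounds `|U| ≤ c_M ε₀^{1/3}`
a.e. on `Q(1/2)`, and the bound is transported back (`ae_norm_le_of_ae_norm_le_zoom`).
[cite: RobinsonRodrigoSadowski2016, Thm. 15.3] [cite: WangZhang2016, §4 Step 1] -/
theorem ae_norm_le_near_point_of_small_scale
    (hw : ∀ a : ℝ, 0 < a → IsSuitableWeakSolutionInBall a (0 : ℝ × EuclideanSpace ℝ (Fin 3)) w π)
    {ε₁ cM : ℝ}
    (H : ∀ (z₀ : ℝ × EuclideanSpace ℝ (Fin 3)) (u : ℝ → EuclideanSpace ℝ (Fin 3) → EuclideanSpace ℝ (Fin 3))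
      (p : ℝ → EuclideanSpace ℝ (Fin 3) → ℝ)
      (G : ℝ → EuclideanSpace ℝ (Fin 3) → EuclideanSpace ℝ (Fin 3) →L[ℝ] EuclideanSpace ℝ (Fin 3)),
      RRS2016.IsSuitablePair (parabolicCylinderOpens 1 z₀) 1 0 u p G →
      ∀ ε₀ : ℝ, 0 < ε₀ → ε₀ ≤ ε₁ → RRS2016.Small ε₀ u p z₀ →
        ∀ᵐ w ∂(volume.restrict (parabolicCylinder (1 / 2) z₀)), ‖u w.1 w.2‖ ≤ cM * ε₀ ^ (1 / 3 : ℝ))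
    {θ : ℝ} (hθ : 0 < θ) (hθ1 : θ ≤ 1) {z₂ : ℝ × EuclideanSpace ℝ (Fin 3)} (ht₂ : z₂.1 < 0)
    {ε₀ : ℝ} (hε₀ : 0 < ε₀) (hε₀₁ : ε₀ ≤ ε₁)
    (hsmall : cknC θ z₂ w + cknD θ z₂ π ≤ ENNReal.ofReal ε₀) :
    ∀ᵐ z ∂(volume.restrict (parabolicCylinder (θ / 2) z₂)),
      ‖w z.1 z.2‖ ≤ cM * ε₀ ^ (1 / 3 : ℝ) / θ := by
  have hθ2 : 0 < θ ^ 2 := pow_pos hθ 2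
  -- a large cylinder containing the closed box `[t₂ - θ², t₂] × B̄(x₂, θ)`
  set a : ℝ := ‖z₂.2‖ + θ + 1 - z₂.1 with ha
  have ha1 : 1 ≤ a := by rw [ha]; have := norm_nonneg z₂.2; linarith
  have hapos : 0 < a := one_pos.trans_le ha1
  have hsol := (hw a hapos).1
  -- the zoom about `z₂` is a suitable weak solution on the preimage of `Q(a)`
  set Q' : Opens (ℝ × EuclideanSpace ℝ (Fin 3)) :=
    stPreimage (θ ^ 2) θ z₂.1 z₂.2 (parabolicCylinderOpens a (0 : ℝ × EuclideanSpace ℝ (Fin 3))) with hQ'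
  have hsol' : IsSuitableWeakSolutionOn Q' 1 0 (θ • stPull (θ ^ 2) θ z₂.1 z₂.2 w)
      (θ ^ 2 • stPull (θ ^ 2) θ z₂.1 z₂.2 π) := by
    have h0 := hsol.stRescale hθ hθ (sq θ) z₂.1 z₂.2
    have hvisc : θ * 1 / θ = 1 := by field_simp
    have hforce : ((θ ^ 2 * θ) • stPull (θ ^ 2) θ z₂.1 z₂.2
        (0 : ℝ → EuclideanSpace ℝ (Fin 3) → EuclideanSpace ℝ (Fin 3))) = 0 := by
      funext s y; simp [stPull]
    rw [hvisc, hforce] at h0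
    exact h0
  -- the closure of `Q(1)` lies in the preimage, because `t₂ < 0`
  have hcl : closure (parabolicCylinder 1 (0 : ℝ × EuclideanSpace ℝ (Fin 3))) ⊆
      (Q' : Set (ℝ × EuclideanSpace ℝ (Fin 3))) := by
    intro z hz
    have hz' := closure_parabolicCylinder_subset 1 (0 : ℝ × EuclideanSpace ℝ (Fin 3)) hz
    simp only [Prod.fst_zero, Prod.snd_zero, one_pow, zero_sub] at hz'
    obtain ⟨hs, hy⟩ := hz'
    rw [mem_closedBall, dist_zero_right] at hy
    show stAffine (θ ^ 2) θ z₂.1 z₂.2 z ∈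
      ((parabolicCylinderOpens a (0 : ℝ × EuclideanSpace ℝ (Fin 3)) :
        Opens (ℝ × EuclideanSpace ℝ (Fin 3))) : Set (ℝ × EuclideanSpace ℝ (Fin 3)))
    rw [coe_parabolicCylinderOpens, stAffine_apply, mem_parabolicCylinder]
    simp only [Prod.fst_zero, Prod.snd_zero, zero_sub, dist_zero_right]
    have haa : a ≤ a ^ 2 := by nlinarith
    have hθs : -θ ^ 2 ≤ θ ^ 2 * z.1 := by nlinarith [hs.1]
    have hθs' : θ ^ 2 * z.1 ≤ 0 := mul_nonpos_of_nonneg_of_nonpos hθ2.le hs.2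
    have hθθ : θ ^ 2 ≤ θ := by nlinarith
    refine ⟨⟨?_, by linarith⟩, ?_⟩
    · have : -a ^ 2 ≤ -a := by linarith
      have hx := norm_nonneg z₂.2
      calc -a ^ 2 ≤ -a := this
        _ < z₂.1 - θ ^ 2 := by rw [ha]; linarith
        _ ≤ z₂.1 + θ ^ 2 * z.1 := by linarith
    · calc ‖z₂.2 + θ • z.2‖ ≤ ‖z₂.2‖ + ‖θ • z.2‖ := norm_add_le _ _
        _ = ‖z₂.2‖ + θ * ‖z.2‖ := by rw [norm_smul, Real.norm_eq_abs, abs_of_pos hθ]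
        _ ≤ ‖z₂.2‖ + θ * 1 := by gcongr
        _ < a := by rw [ha]; linarith
  -- the RRS suitable pair on `Q(1)` (zero force)
  have hfi : LocallyIntegrableOn (uncurry (0 : ℝ → EuclideanSpace ℝ (Fin 3) → EuclideanSpace ℝ (Fin 3)))
      (Q' : Set (ℝ × EuclideanSpace ℝ (Fin 3))) volume :=
    (locallyIntegrable_zero).locallyIntegrableOn _
  have hdivf : ∀ φ : ℝ → EuclideanSpace ℝ (Fin 3) → ℝ, IsSpaceTimeTestOn Q' φ →
      ∫ t, ∫ x, ⟪(0 : ℝ → EuclideanSpace ℝ (Fin 3) → EuclideanSpace ℝ (Fin 3)) t x, gradient (φ t) x⟫ = 0 := by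
    intro φ _; simp
  obtain ⟨G, hpair⟩ := hsol'.rrs_isSuitablePair hfi hdivf hcl
  -- smallness on `Q(1)`: `∫ |U|³ + |P|^{3/2} = C(θ; z₂) + D(θ; z₂)`
  have hSmall : RRS2016.Small ε₀ (θ • stPull (θ ^ 2) θ z₂.1 z₂.2 w)
      (θ ^ 2 • stPull (θ ^ 2) θ z₂.1 z₂.2 π) (0 : ℝ × EuclideanSpace ℝ (Fin 3)) := by
    have hmeas : AEMeasurable (fun q : ℝ × EuclideanSpace ℝ (Fin 3) =>
        ‖(θ • stPull (θ ^ 2) θ z₂.1 z₂.2 w) q.1 q.2‖ₑ ^ (3 : ℕ))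
        (volume.restrict (parabolicCylinder 1 (0 : ℝ × EuclideanSpace ℝ (Fin 3)))) := by
      have h1 : AEStronglyMeasurable (uncurry (θ • stPull (θ ^ 2) θ z₂.1 z₂.2 w))
          (volume.restrict (parabolicCylinder 1 (0 : ℝ × EuclideanSpace ℝ (Fin 3)))) :=
        (hsol'.distributional.1.aestronglyMeasurable).mono_measure
          (Measure.restrict_mono (subset_closure.trans hcl) le_rfl)
      exact h1.enorm.pow_const 3
    show ∫⁻ q in parabolicCylinder 1 (0 : ℝ × EuclideanSpace ℝ (Fin 3)),
        (‖(θ • stPull (θ ^ 2) θ z₂.1 z₂.2 w) q.1 q.2‖ₑ ^ (3 : ℕ) +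
          ‖(θ ^ 2 • stPull (θ ^ 2) θ z₂.1 z₂.2 π) q.1 q.2‖ₑ ^ (3 / 2 : ℝ)) ≤ ENNReal.ofReal ε₀
    rw [lintegral_add_left' hmeas, lintegral_cube_zoom hθ z₂ w, lintegral_pressure_zoom hθ z₂ π]
    exact hsmall
  have hbd := H 0 _ _ G hpair ε₀ hε₀ hε₀₁ hSmall
  exact ae_norm_le_of_ae_norm_le_zoom hθ z₂ hbd

end NearPoint

/-! ### The choice of the scale -/

section Scale

/-- `C(θ; z) ≤ θ⁻² C(1; z)` for `0 < θ ≤ 1` (monotonicity of the un-normalised integral). [folklore] -/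
theorem cknC_le_inv_sq_mul_cknC_one {θ : ℝ} (hθ : 0 < θ) (hθ1 : θ ≤ 1)
    (z : ℝ × EuclideanSpace ℝ (Fin 3)) (u : ℝ → EuclideanSpace ℝ (Fin 3) → EuclideanSpace ℝ (Fin 3)) :
    cknC θ z u ≤ ENNReal.ofReal ((θ ^ 2)⁻¹) * cknC 1 z u := by
  rw [cknC, cknC, Lemma142.inv_ofReal_sq hθ, ENNReal.ofReal_one, one_pow, inv_one, one_mul]
  exact mul_le_mul' le_rfl (lintegral_mono_set (parabolicCylinder_mono hθ.le hθ1 z))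

/-- **Both scaled quantities are small at the scale `θ(K)`.** With `c` the constant of the
pressure decay estimate, `θ = min(1/2, ε/(4(c+1)(K+1)))` and `η = θ² ε/(4(c+1))`: if `(w, π)`
solves the system in the sense of distributions on an open set containing `Q(z, 1)`, `D(1; z) ≤ K`
and `C(1; z) ≤ η`, then `C(θ; z) + D(θ; z) ≤ ε` — from
`D(θ; z) ≤ c (θ D(1; z) + θ⁻² C(1; z))` (`seregin_sverak_pressure_decay_holds`) and
`C(θ; z) ≤ θ⁻² C(1; z)`. [cite: SereginSverak2009, proof of Lemma 3.5, (as13)] -/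
theorem cknC_add_cknD_small_of_cknC_one_small {c : ℝ≥0}
    (hc : ∀ (Q : Opens (ℝ × EuclideanSpace ℝ (Fin 3)))
      (u : ℝ → EuclideanSpace ℝ (Fin 3) → EuclideanSpace ℝ (Fin 3)) (p : ℝ → EuclideanSpace ℝ (Fin 3) → ℝ),
      IsDistributionalNSSolutionOn Q 1 0 u p →
      ∀ (z : ℝ × EuclideanSpace ℝ (Fin 3)) (r θ : ℝ), 0 < r → 0 < θ → θ ≤ 1 →
        parabolicCylinder r z ⊆ (Q : Set (ℝ × EuclideanSpace ℝ (Fin 3))) →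
        cknD (θ * r) z p ≤
          c * (ENNReal.ofReal θ * cknD r z p + ENNReal.ofReal ((θ⁻¹) ^ 2) * cknC r z u))
    {K : ℝ≥0} {ε : ℝ} (hε : 0 < ε)
    {Q : Opens (ℝ × EuclideanSpace ℝ (Fin 3))} (hsol : IsDistributionalNSSolutionOn Q 1 0 w π)
    {z : ℝ × EuclideanSpace ℝ (Fin 3)} (hQ : parabolicCylinder 1 z ⊆ (Q : Set (ℝ × EuclideanSpace ℝ (Fin 3))))
    (hD : cknD 1 z π ≤ K)
    (hC : cknC 1 z w ≤ ENNReal.ofReal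
      ((min (1 / 2) (ε / (4 * ((c : ℝ) + 1) * ((K : ℝ) + 1)))) ^ 2 * ε / (4 * ((c : ℝ) + 1)))) :
    cknC (min (1 / 2) (ε / (4 * ((c : ℝ) + 1) * ((K : ℝ) + 1)))) z w +
      cknD (min (1 / 2) (ε / (4 * ((c : ℝ) + 1) * ((K : ℝ) + 1)))) z π ≤ ENNReal.ofReal ε := by
  set θ : ℝ := min (1 / 2) (ε / (4 * ((c : ℝ) + 1) * ((K : ℝ) + 1))) with hθdef
  set η : ℝ := θ ^ 2 * ε / (4 * ((c : ℝ) + 1)) with hηdef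
  have hc0 : (0 : ℝ) ≤ c := c.coe_nonneg
  have hK0 : (0 : ℝ) ≤ K := K.coe_nonneg
  have hθpos : 0 < θ := lt_min (by norm_num) (by positivity)
  have hθ1 : θ ≤ 1 := (min_le_left _ _).trans (by norm_num)
  have hθ2 : 0 < θ ^ 2 := pow_pos hθpos 2
  have hηpos : 0 < η := by positivity
  -- the two real inequalities behind the choice
  have hθK : (c : ℝ) * θ * K ≤ ε / 4 := by
    have h1 : θ ≤ ε / (4 * ((c : ℝ) + 1) * ((K : ℝ) + 1)) := min_le_right _ _
    have h2 : (c : ℝ) * K ≤ ((c : ℝ) + 1) * ((K : ℝ) + 1) := by nlinarith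
    calc (c : ℝ) * θ * K = θ * ((c : ℝ) * K) := by ring
      _ ≤ ε / (4 * ((c : ℝ) + 1) * ((K : ℝ) + 1)) * (((c : ℝ) + 1) * ((K : ℝ) + 1)) :=
          mul_le_mul h1 h2 (by positivity) (by positivity)
      _ = ε / 4 := by field_simp
  have hθη : (θ ^ 2)⁻¹ * η = ε / (4 * ((c : ℝ) + 1)) := by
    rw [hηdef]; field_simp
  have hcθη : (c : ℝ) * ((θ ^ 2)⁻¹ * η) ≤ ε / 4 := by
    rw [hθη]
    have : (c : ℝ) * (ε / (4 * ((c : ℝ) + 1))) = (ε / 4) * ((c : ℝ) / ((c : ℝ) + 1)) := by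
      field_simp
    rw [this]
    have h1 : (c : ℝ) / ((c : ℝ) + 1) ≤ 1 := by
      rw [div_le_one (by positivity)]; linarith
    calc ε / 4 * ((c : ℝ) / ((c : ℝ) + 1)) ≤ ε / 4 * 1 :=
          mul_le_mul_of_nonneg_left h1 (by positivity)
      _ = ε / 4 := mul_one _
  have hθη' : (θ ^ 2)⁻¹ * η ≤ ε / 4 := by
    rw [hθη]
    rw [div_le_div_iff₀ (by positivity) (by positivity)]
    nlinarith
  -- `C(θ) ≤ θ⁻² η`
  have hC' : cknC θ z w ≤ ENNReal.ofReal ((θ ^ 2)⁻¹ * η) := by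
    refine (cknC_le_inv_sq_mul_cknC_one hθpos hθ1 z w).trans ?_
    rw [ENNReal.ofReal_mul (by positivity)]
    exact mul_le_mul' le_rfl hC
  -- `D(θ) ≤ c (θ K + θ⁻² η)`
  have hD' : cknD θ z π ≤ ENNReal.ofReal ((c : ℝ) * θ * K + (c : ℝ) * ((θ ^ 2)⁻¹ * η)) := by
    have h := hc Q w π hsol z 1 θ one_pos hθpos hθ1 hQ
    rw [mul_one] at h
    refine h.trans ?_
    have e1 : (c : ℝ≥0∞) * (ENNReal.ofReal θ * cknD 1 z π + ENNReal.ofReal ((θ⁻¹) ^ 2) * cknC 1 z w) ≤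
        (c : ℝ≥0∞) * (ENNReal.ofReal θ * (K : ℝ≥0∞) + ENNReal.ofReal ((θ⁻¹) ^ 2) * ENNReal.ofReal η) :=
      mul_le_mul' le_rfl (add_le_add (mul_le_mul' le_rfl hD) (mul_le_mul' le_rfl hC))
    refine e1.trans (le_of_eq ?_)
    rw [inv_pow, show ((c : ℝ≥0) : ℝ≥0∞) = ENNReal.ofReal (c : ℝ) by simp,
      show ((K : ℝ≥0) : ℝ≥0∞) = ENNReal.ofReal (K : ℝ) by simp,
      ← ENNReal.ofReal_mul hθpos.le, ← ENNReal.ofReal_mul (by positivity),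
      ← ENNReal.ofReal_add (by positivity) (by positivity), ← ENNReal.ofReal_mul hc0]
    congr 1
    ring
  -- sum
  calc cknC θ z w + cknD θ z π
      ≤ ENNReal.ofReal ((θ ^ 2)⁻¹ * η) + ENNReal.ofReal ((c : ℝ) * θ * K + (c : ℝ) * ((θ ^ 2)⁻¹ * η)) :=
        add_le_add hC' hD'
    _ = ENNReal.ofReal ((θ ^ 2)⁻¹ * η + ((c : ℝ) * θ * K + (c : ℝ) * ((θ ^ 2)⁻¹ * η))) := by
        rw [← ENNReal.ofReal_add (by positivity) (by positivity)]
    _ ≤ ENNReal.ofReal ε := ENNReal.ofReal_le_ofReal (by linarith)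

end Scale

/-! ### The far-field bound -/

section FarField

/-- **Far-field boundedness from far-field smallness of the velocity** (Wang–Zhang 2017, §4
Step 1, last paragraph; the Besov replacement of ESS 2003, (3.24)). Let `(w, π)` be suitable in
every `Q(a)`, `a > 0`, with `D(1; z₀) ≤ K` at every apex `z₀ = (t₀, x₀)`, `t₀ < 0`, and suppose the
velocity is small in the far field at unit scale, uniformly in time: for every `η > 0` there is `R`
with `C(1; z₀) ≤ η` whenever `-(T+1) < t₀ < 0` and `|x₀| > R`. Then there are `L` and `R₀ > 0` with
`|w| ≤ L` a.e. on `]-T, 0[ × {|x| > R₀}`. Proof: at the scale `θ(K)` of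
`cknC_add_cknD_small_of_cknC_one_small` both `C` and `D` are below the threshold `ε₁` of RRS
Thm. 15.3 at every far apex, so `|w| ≤ c_M ε₁^{1/3}/θ` a.e. on `Q(z₀, θ/2)`
(`ae_norm_le_near_point_of_small_scale`); a countable dense family of far apices covers the far
region. [cite: WangZhang2016, §4 Step 1] [cite: EscauriazaSereginSverak2003, §3 (3.24)] [cite: RobinsonRodrigoSadowski2016, Thm. 15.3] -/
theorem exists_farField_ae_norm_le_of_cknC_farField_small
    (hw : ∀ a : ℝ, 0 < a → IsSuitableWeakSolutionInBall a (0 : ℝ × EuclideanSpace ℝ (Fin 3)) w π)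
    {K : ℝ≥0} (hDK : ∀ z₀ : ℝ × EuclideanSpace ℝ (Fin 3), z₀.1 < 0 → cknD 1 z₀ π ≤ K)
    {T : ℝ}
    (hfarC : ∀ η : ℝ, 0 < η → ∃ R : ℝ, ∀ z₀ : ℝ × EuclideanSpace ℝ (Fin 3),
      -(T + 1) < z₀.1 → z₀.1 < 0 → R < ‖z₀.2‖ → cknC 1 z₀ w ≤ ENNReal.ofReal η) :
    ∃ L R₀ : ℝ, 0 < R₀ ∧
      ∀ᵐ z ∂(volume.restrict (Ioo (-T) 0 ×ˢ (closedBall (0 : EuclideanSpace ℝ (Fin 3)) R₀)ᶜ)),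
        ‖w z.1 z.2‖ ≤ L := by
  classical
  obtain ⟨ε₁, cM, hε₁, hcM, H⟩ := RRS2016.theorem15_3_holds
  obtain ⟨c, hc⟩ := seregin_sverak_pressure_decay_holds.ratio
  -- the scale and the smallness level
  set θ : ℝ := min (1 / 2) (ε₁ / (4 * ((c : ℝ) + 1) * ((K : ℝ) + 1))) with hθdef
  set η : ℝ := θ ^ 2 * ε₁ / (4 * ((c : ℝ) + 1)) with hηdef
  have hc0 : (0 : ℝ) ≤ c := c.coe_nonneg
  have hK0 : (0 : ℝ) ≤ K := K.coe_nonneg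
  have hθpos : 0 < θ := lt_min (by norm_num) (by positivity)
  have hθhalf : θ ≤ 1 / 2 := min_le_left _ _
  have hθ1 : θ ≤ 1 := hθhalf.trans (by norm_num)
  have hηpos : 0 < η := by positivity
  obtain ⟨R, hR⟩ := hfarC η hηpos
  set L : ℝ := cM * ε₁ ^ (1 / 3 : ℝ) / θ with hL
  refine ⟨L, max R 0 + 1, by positivity, ?_⟩
  -- the bound near every far apex
  have hnear : ∀ z₂ : ℝ × EuclideanSpace ℝ (Fin 3), -(T + 1) < z₂.1 → z₂.1 < 0 → R < ‖z₂.2‖ →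
      ∀ᵐ z ∂(volume.restrict (parabolicCylinder (θ / 2) z₂)), ‖w z.1 z.2‖ ≤ L := by
    intro z₂ hT₂ ht₂ hx₂
    -- a large cylinder containing `Q(z₂, 1)`
    set a : ℝ := ‖z₂.2‖ + 2 - z₂.1 with ha
    have ha1 : 1 ≤ a := by rw [ha]; have := norm_nonneg z₂.2; linarith
    have hapos : 0 < a := one_pos.trans_le ha1
    have hQ : parabolicCylinder 1 z₂ ⊆
        ((parabolicCylinderOpens a (0 : ℝ × EuclideanSpace ℝ (Fin 3)) :
          Opens (ℝ × EuclideanSpace ℝ (Fin 3))) : Set (ℝ × EuclideanSpace ℝ (Fin 3))) := by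
      intro q hq
      rw [coe_parabolicCylinderOpens, mem_parabolicCylinder]
      rw [mem_parabolicCylinder] at hq
      simp only [Prod.fst_zero, Prod.snd_zero, zero_sub, dist_zero_right]
      obtain ⟨⟨hq1, hq2⟩, hq3⟩ := hq
      rw [one_pow] at hq1
      have haa : a ≤ a ^ 2 := by nlinarith
      refine ⟨⟨?_, hq2.trans ht₂⟩, ?_⟩
      · have hx := norm_nonneg z₂.2
        calc -a ^ 2 ≤ -a := by linarith
          _ < z₂.1 - 1 := by rw [ha]; linarith
          _ < q.1 := hq1
      · rw [dist_eq_norm] at hq3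
        calc ‖q.2‖ = ‖(q.2 - z₂.2) + z₂.2‖ := by rw [sub_add_cancel]
          _ ≤ ‖q.2 - z₂.2‖ + ‖z₂.2‖ := norm_add_le _ _
          _ < a := by rw [ha]; linarith
    have hsmall := cknC_add_cknD_small_of_cknC_one_small hc hε₁ (hw a hapos).1.distributional hQ
      (hDK z₂ ht₂) (hR z₂ hT₂ ht₂ hx₂)
    exact ae_norm_le_near_point_of_small_scale hw H hθpos hθ1 ht₂ hε₁ le_rfl hsmall
  -- a countable dense family of far apices
  obtain ⟨s, hsc, hsd⟩ := TopologicalSpace.exists_countable_dense (ℝ × EuclideanSpace ℝ (Fin 3))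
  set s' : Set (ℝ × EuclideanSpace ℝ (Fin 3)) :=
    {z₀ ∈ s | -(T + 1) < z₀.1 ∧ z₀.1 < 0 ∧ R < ‖z₀.2‖} with hs'
  have hs'c : s'.Countable := hsc.mono (sep_subset _ _)
  have hall : ∀ᵐ z ∂(volume : Measure (ℝ × EuclideanSpace ℝ (Fin 3))), ∀ z₀ ∈ s',
      z ∈ parabolicCylinder (θ / 2) z₀ → ‖w z.1 z.2‖ ≤ L := by
    rw [ae_ball_iff hs'c]
    rintro z₀ ⟨-, h1, h2, h3⟩
    have h := hnear z₀ h1 h2 h3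
    exact (ae_restrict_iff' (isOpen_parabolicCylinder _ _).measurableSet).1 h
  have hmeas : MeasurableSet (Ioo (-T) 0 ×ˢ (closedBall (0 : EuclideanSpace ℝ (Fin 3)) (max R 0 + 1))ᶜ) :=
    measurableSet_Ioo.prod measurableSet_closedBall.compl
  filter_upwards [ae_restrict_of_ae (μ := volume)
    (s := Ioo (-T) 0 ×ˢ (closedBall (0 : EuclideanSpace ℝ (Fin 3)) (max R 0 + 1))ᶜ) hall,
    ae_restrict_mem hmeas] with z hz hzmem
  obtain ⟨⟨hzt1, hzt2⟩, hzx⟩ := hzmem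
  rw [mem_compl_iff, mem_closedBall, dist_zero_right, not_le] at hzx
  -- a far apex `z₀ ∈ s` with `z ∈ Q(z₀, θ/2)`
  set U : Set (ℝ × EuclideanSpace ℝ (Fin 3)) :=
    Ioo z.1 (min 0 (z.1 + θ ^ 2 / 8)) ×ˢ (ball z.2 (θ / 2) ∩ {x | R < ‖x‖}) with hU
  have hUo : IsOpen U :=
    isOpen_Ioo.prod (isOpen_ball.inter (isOpen_lt continuous_const continuous_norm))
  have hzR : R < ‖z.2‖ := by
    have := le_max_left R 0
    linarith
  have hUne : U.Nonempty := by
    have ht : z.1 < min 0 (z.1 + θ ^ 2 / 8) := lt_min hzt2 (by nlinarith [pow_pos hθpos 2])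
    obtain ⟨t, ht1, ht2⟩ := exists_between ht
    exact ⟨(t, z.2), ⟨ht1, ht2⟩, mem_ball_self (by positivity), hzR⟩
  obtain ⟨z₀, hz₀U, hz₀s⟩ := hsd.inter_open_nonempty U hUo hUne
  obtain ⟨⟨hτ1, hτ2⟩, hξ1, hξ2⟩ := hz₀U
  have hτ0 : z₀.1 < 0 := lt_of_lt_of_le hτ2 (min_le_left _ _)
  have hτ3 : z₀.1 < z.1 + θ ^ 2 / 8 := lt_of_lt_of_le hτ2 (min_le_right _ _)
  refine hz z₀ ⟨hz₀s, by linarith, hτ0, hξ2⟩ ?_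
  rw [mem_parabolicCylinder]
  refine ⟨⟨by nlinarith [pow_pos hθpos 2], hτ1⟩, ?_⟩
  rw [dist_comm]
  exact mem_ball.1 hξ1

end FarField

end Literature.Analysis.FluidPDE

end
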